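import Summits.CriticalPhenomena.PercolationContinuityZ3.Theorems.PercNearOneGluingNoHeavyLowerTailForestRayleighTwoSeparationSums
import HarnessLib

/-!
# Weighted forest negative correlation — 2-sums I: the real algebra of the two-state decomposition; the marker case

Notation (`…ForestRayleighTools`, `…TwoSeparation*`): `Z(D;K) = Σ_{G ⊆ D, ⟨G ∪ K⟩ acyclic} ∏ w`;
`(R)(D;K;e,f) : Z(D;K∪{e,f})·Z(D;K) ≤ Z(D;K∪e)·Z(D;K∪f)`; two sides `D₁,K₁` (edges on `S₁`) and
`D₂,K₂` (edges on `S₂`), `S₁ ∩ S₂ ⊆ {s,t}`, marker `m = st`. By `forestsW_sep`,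
with `t(X) = Z(D₁;K₁∪X)`, `u(X) = Z(D₂;K₂∪X)`,

  `Z(D₁∪D₂; K₁∪K₂∪X₁∪X₂) = t(X₁m)·u(X₂) + t(X₁)·u(X₂m) − t(X₁m)·u(X₂m)`.

§1 proves the polynomial inequalities behind the 2-sum theorem (Semple–Welsh 2008 §5 Q.2;
Cocks; Wagner 2008): for `e, f` on the same side `(R)` for the sum is `(R)` for that side with a
virtual free marker of activity `(u − u(m) + ν u(m))/u(m)`; for `e, f` on different sides
`RHS − LHS = (t(e)t(m) − t(em)t)·(u(f)u(m) − u(fm)u)`, a product of two `(R)`-defects.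
§2 treats the case where the marker is itself one of the two Rayleigh edges (`lsm_sep_marker`);
the same-side and different-side cases are in `…ForestRayleighTwoSumCases`.
Theorems only; no definitions, no `sorry`.
-/

open Finset SimpleGraph
open scoped Classical

namespace Summit.CriticalPhenomena.PercolationContinuityZ3.Theorems.ForestRayleigh

/-! ### §1 Real algebra -/

/-- Same side, scaled form: from the one-parameter family of `(R)` for the side with a virtual
free marker (and the pinned-marker instance for the degenerate scale `c = 0`). [elementary] -/
theorem real_sep_same_scaled {c a tK tE tF tEF tM tEM tFM tEFM : ℝ} (hc : 0 ≤ c) (ha : 0 ≤ a)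
    (hlam : ∀ lam : ℝ, 0 ≤ lam →
      (tEF + lam * tEFM) * (tK + lam * tM) ≤ (tE + lam * tEM) * (tF + lam * tFM))
    (hpin : tEFM * tM ≤ tEM * tFM) :
    (c * tEF + a * tEFM) * (c * tK + a * tM) ≤ (c * tE + a * tEM) * (c * tF + a * tFM) := by
  rcases hc.eq_or_lt with hc0 | hc0
  · rw [← hc0]
    have key := mul_le_mul_of_nonneg_left hpin (mul_nonneg ha ha)
    calc (0 * tEF + a * tEFM) * (0 * tK + a * tM) = a * a * (tEFM * tM) := by ring
      _ ≤ a * a * (tEM * tFM) := key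
      _ = (0 * tE + a * tEM) * (0 * tF + a * tFM) := by ring
  · have hl := hlam (a / c) (div_nonneg ha hc)
    have hc' : c ≠ 0 := hc0.ne'
    have key := mul_le_mul_of_nonneg_left hl (mul_nonneg hc hc)
    calc (c * tEF + a * tEFM) * (c * tK + a * tM)
        = c * c * ((tEF + a / c * tEFM) * (tK + a / c * tM)) := by field_simp
      _ ≤ c * c * ((tE + a / c * tEM) * (tF + a / c * tFM)) := key
      _ = (c * tE + a * tEM) * (c * tF + a * tFM) := by field_simp

/-- **Same side** (marker absent or free with activity `ν ≥ 0`): the glued Rayleigh inequality in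
the shape delivered by `forestsW_sep`. [elementary] -/
theorem real_sep_same {ν uK uM tK tE tF tEF tM tEM tFM tEFM : ℝ} (hν : 0 ≤ ν) (huM : 0 ≤ uM)
    (hu : uM ≤ uK)
    (hlam : ∀ lam : ℝ, 0 ≤ lam →
      (tEF + lam * tEFM) * (tK + lam * tM) ≤ (tE + lam * tEM) * (tF + lam * tFM))
    (hpin : tEFM * tM ≤ tEM * tFM) :
    (tEFM * uK + tEF * uM - tEFM * uM + ν * (tEFM * uM)) *
        (tM * uK + tK * uM - tM * uM + ν * (tM * uM)) ≤
      (tEM * uK + tE * uM - tEM * uM + ν * (tEM * uM)) *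
        (tFM * uK + tF * uM - tFM * uM + ν * (tFM * uM)) := by
  have ha : 0 ≤ uK - uM + ν * uM := by nlinarith
  have key := real_sep_same_scaled (tK := tK) (tE := tE) (tF := tF) (tEF := tEF) (tM := tM)
    (tEM := tEM) (tFM := tFM) (tEFM := tEFM) huM ha hlam hpin
  have e₁ : tEFM * uK + tEF * uM - tEFM * uM + ν * (tEFM * uM) =
      uM * tEF + (uK - uM + ν * uM) * tEFM := by ring
  have e₂ : tM * uK + tK * uM - tM * uM + ν * (tM * uM) = uM * tK + (uK - uM + ν * uM) * tM := by
    ring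
  have e₃ : tEM * uK + tE * uM - tEM * uM + ν * (tEM * uM) =
      uM * tE + (uK - uM + ν * uM) * tEM := by ring
  have e₄ : tFM * uK + tF * uM - tFM * uM + ν * (tFM * uM) =
      uM * tF + (uK - uM + ν * uM) * tFM := by ring
  rw [e₁, e₂, e₃, e₄]
  exact key

/-- **Same side, marker absent** (`ν = 0`). [elementary] -/
theorem real_sep_same₀ {uK uM tK tE tF tEF tM tEM tFM tEFM : ℝ} (huM : 0 ≤ uM) (hu : uM ≤ uK)
    (hlam : ∀ lam : ℝ, 0 ≤ lam →
      (tEF + lam * tEFM) * (tK + lam * tM) ≤ (tE + lam * tEM) * (tF + lam * tFM))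
    (hpin : tEFM * tM ≤ tEM * tFM) :
    (tEFM * uK + tEF * uM - tEFM * uM) * (tM * uK + tK * uM - tM * uM) ≤
      (tEM * uK + tE * uM - tEM * uM) * (tFM * uK + tF * uM - tFM * uM) := by
  have key := real_sep_same (ν := 0) le_rfl huM hu hlam hpin
  simp only [zero_mul, add_zero] at key
  exact key

/-- **Different sides** (marker absent or free with activity `ν`): `RHS − LHS` is the product of
the two one-sided Rayleigh defects. [elementary] -/
theorem real_sep_split {ν tK tE tM tEM uK uF uM uFM : ℝ} (hRe : tEM * tK ≤ tE * tM)
    (hRf : uFM * uK ≤ uF * uM) :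
    (tEM * uF + tE * uFM - tEM * uFM + ν * (tEM * uFM)) *
        (tM * uK + tK * uM - tM * uM + ν * (tM * uM)) ≤
      (tEM * uK + tE * uM - tEM * uM + ν * (tEM * uM)) *
        (tM * uF + tK * uFM - tM * uFM + ν * (tM * uFM)) := by
  have key : (tEM * uK + tE * uM - tEM * uM + ν * (tEM * uM)) *
        (tM * uF + tK * uFM - tM * uFM + ν * (tM * uFM)) -
      (tEM * uF + tE * uFM - tEM * uFM + ν * (tEM * uFM)) *
        (tM * uK + tK * uM - tM * uM + ν * (tM * uM)) =
      (tE * tM - tEM * tK) * (uF * uM - uFM * uK) := by ring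
  have hprod : 0 ≤ (tE * tM - tEM * tK) * (uF * uM - uFM * uK) :=
    mul_nonneg (sub_nonneg.2 hRe) (sub_nonneg.2 hRf)
  linarith

/-- **Different sides, marker absent** (`ν = 0`). [elementary] -/
theorem real_sep_split₀ {tK tE tM tEM uK uF uM uFM : ℝ} (hRe : tEM * tK ≤ tE * tM)
    (hRf : uFM * uK ≤ uF * uM) :
    (tEM * uF + tE * uFM - tEM * uFM) * (tM * uK + tK * uM - tM * uM) ≤
      (tEM * uK + tE * uM - tEM * uM) * (tM * uF + tK * uFM - tM * uFM) := by
  have key := real_sep_split (ν := 0) hRe hRf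
  simp only [zero_mul, add_zero] at key
  exact key

/-- **The marker is one of the two Rayleigh edges** (`e = m`, `f` on side 2):
`RHS − LHS = t(m)²·(u(f)u(m) − u(fm)u)`. [elementary] -/
theorem real_sep_marker {tK tM uK uF uM uFM : ℝ} (hRf : uFM * uK ≤ uF * uM) :
    (tM * uFM) * (tM * uK + tK * uM - tM * uM) ≤ (tM * uM) * (tM * uF + tK * uFM - tM * uFM) := by
  have key : (tM * uM) * (tM * uF + tK * uFM - tM * uFM) - (tM * uFM) * (tM * uK + tK * uM - tM * uM)
      = tM ^ 2 * (uF * uM - uFM * uK) := by ring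
  have hprod : 0 ≤ tM ^ 2 * (uF * uM - uFM * uK) := mul_nonneg (sq_nonneg tM) (sub_nonneg.2 hRf)
  linarith

/-- **Marker pinned, same side**: a common factor `u(m)²`. [elementary] -/
theorem real_sep_pin_same {uM tM tEM tFM tEFM : ℝ} (huM : 0 ≤ uM) (hpin : tEFM * tM ≤ tEM * tFM) :
    (tEFM * uM) * (tM * uM) ≤ (tEM * uM) * (tFM * uM) := by
  have key := mul_le_mul_of_nonneg_left hpin (mul_nonneg huM huM)
  calc (tEFM * uM) * (tM * uM) = uM * uM * (tEFM * tM) := by ring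
    _ ≤ uM * uM * (tEM * tFM) := key
    _ = (tEM * uM) * (tFM * uM) := by ring

/-! ### §2 The marker is one of the two Rayleigh edges -/

section Marker

variable {V : Type*} [Fintype V] [DecidableEq V]

omit [Fintype V] [DecidableEq V] in
/-- Restricting a pointwise hypothesis to a sub-family. [elementary] -/
theorem forall_mem_mono {A B : Finset (Sym2 V)} {P : Sym2 V → Prop} (hAB : A ⊆ B)
    (h : ∀ z ∈ B, P z) : ∀ z ∈ A, P z := fun z hz => h z (hAB hz)

/-- **2-sum, `e = m` the marker, `f` on side 2.** `(R)(D₁∪D₂; K₁∪K₂; m,f)` from `(R)(D₂;K₂;f,m)`.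
[S–W 2008 §5 Q.2, graphic case] -/
theorem lsm_sep_marker (w : Sym2 V → ℝ) {D₁ K₁ D₂ K₂ : Finset (Sym2 V)}
    {S₁ S₂ : Set V} {s t : V} (f : Sym2 V)
    (h₁ : ∀ z ∈ D₁ ∪ K₁, ∀ x ∈ z, x ∈ S₁) (h₂ : ∀ z ∈ D₂ ∪ insert f K₂, ∀ x ∈ z, x ∈ S₂)
    (hS : ∀ x, x ∈ S₁ → x ∈ S₂ → x = s ∨ x = t) (hst : s ≠ t)
    (hL₁ : ∀ z ∈ D₁ ∪ K₁, ¬z.IsDiag) (hL₂ : ∀ z ∈ D₂ ∪ insert f K₂, ¬z.IsDiag)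
    (hm₁ : s(s, t) ∉ D₁ ∪ K₁) (hm₂ : s(s, t) ∉ D₂ ∪ insert f K₂) (hD : Disjoint D₁ D₂)
    (hRfRaw : (∑ G ∈ D₂.powerset.filter (fun G =>
        (fromEdgeSet ((G ∪ (insert f (insert s(s, t) K₂)) : Finset (Sym2 V)) : Set (Sym2 V))).IsAcyclic), ∏ x ∈ G, w x) *
      (∑ G ∈ D₂.powerset.filter (fun G =>
        (fromEdgeSet ((G ∪ (K₂) : Finset (Sym2 V)) : Set (Sym2 V))).IsAcyclic), ∏ x ∈ G, w x) ≤
      (∑ G ∈ D₂.powerset.filter (fun G =>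
        (fromEdgeSet ((G ∪ (insert f K₂) : Finset (Sym2 V)) : Set (Sym2 V))).IsAcyclic), ∏ x ∈ G, w x) *
      (∑ G ∈ D₂.powerset.filter (fun G =>
        (fromEdgeSet ((G ∪ (insert s(s, t) K₂) : Finset (Sym2 V)) : Set (Sym2 V))).IsAcyclic), ∏ x ∈ G, w x)) :
    (∑ G ∈ (D₁ ∪ D₂).powerset.filter (fun G =>
        (fromEdgeSet ((G ∪ (insert s(s, t) (insert f (K₁ ∪ K₂))) : Finset (Sym2 V)) : Set (Sym2 V))).IsAcyclic), ∏ x ∈ G, w x) *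
      (∑ G ∈ (D₁ ∪ D₂).powerset.filter (fun G =>
        (fromEdgeSet ((G ∪ (K₁ ∪ K₂) : Finset (Sym2 V)) : Set (Sym2 V))).IsAcyclic), ∏ x ∈ G, w x) ≤
    (∑ G ∈ (D₁ ∪ D₂).powerset.filter (fun G =>
        (fromEdgeSet ((G ∪ (insert s(s, t) (K₁ ∪ K₂)) : Finset (Sym2 V)) : Set (Sym2 V))).IsAcyclic), ∏ x ∈ G, w x) *
      (∑ G ∈ (D₁ ∪ D₂).powerset.filter (fun G =>
        (fromEdgeSet ((G ∪ (insert f (K₁ ∪ K₂)) : Finset (Sym2 V)) : Set (Sym2 V))).IsAcyclic), ∏ x ∈ G, w x) := by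
  have hRf := hRfRaw
  simp only [Finset.insert_comm f s(s, t) K₂] at hRf
  have hset₃ : insert f (K₁ ∪ K₂) = K₁ ∪ insert f K₂ := by rw [Finset.union_insert]
  have s2 : D₂ ∪ K₂ ⊆ D₂ ∪ insert f K₂ :=
    Finset.union_subset_union (subset_refl _) (Finset.subset_insert f K₂)
  simp only [hset₃]
  rw [forestsW_sep_pin w h₁ h₂ hS hst hL₁ hL₂
      hm₁ hm₂ hD,
    forestsW_sep w h₁ (forall_mem_mono s2 h₂) hS hst hL₁ (forall_mem_mono s2 hL₂)
      hm₁ (fun h => hm₂ (s2 h)) hD,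
    forestsW_sep_pin w h₁ (forall_mem_mono s2 h₂) hS hst hL₁ (forall_mem_mono s2 hL₂)
      hm₁ (fun h => hm₂ (s2 h)) hD,
    forestsW_sep w h₁ h₂ hS hst hL₁ hL₂
      hm₁ hm₂ hD]
  exact real_sep_marker hRf

end Marker

end Summit.CriticalPhenomena.PercolationContinuityZ3.Theorems.ForestRayleigh
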